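import Mathlib
import HarnessLib
import Literature.Geometry.Lorentzian.GradientSection
import Literature.Geometry.Lorentzian.Stationary

/-!
# The gradient of a smooth function is a smooth vector field (crux `NonTrappingHawkingRigidity`,
# stmt-FinalStateConjecture-13896, line `Sketch`, stub S3 helper)

For a `C^∞` pseudo-Riemannian metric `g` on `M` and a function `F : M → ℝ` of class `C^∞` on an
open set `U`, the GRADIENT section `y ↦ grad F(y) = ♯(dF_y)` (`PseudoRiemannianMetric.sharp` of
the differential `mvfderiv`) is a `C^∞` section of `TM` on `U` (`contMDiffOn_sharp_mvfderiv`).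
This is the `C^∞` form of the tree's `mdifferentiableAt_sharp_mvfderiv`
(`GradientSection.lean`, same proof): on the chart domain of a point, `grad F` is the frame
combination `∑ₗ (∑ₖ dF(∂ₖ) 𝒢^{kl}) ∂ₗ` (`eq_sum_gram_inv_smul_localFrame`) with `C^∞`
coefficients (`contMDiffAt_mvfderiv_localFrame_infty`, `contMDiffOn_gram_localFrame_inv`).
Also recorded: the defining identity `g(grad F, u) = dF(u)` and the consequences used by the
slab patching (`dF(grad F) = g(grad F, grad F)`, a vector `w` with `dF = g(w, ·)` IS the
gradient). Everything is proved; no definitions. O'Neill 1983, Ch. 3, Def. 3.9 ff. (gradient).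
-/

noncomputable section

-- D-0017: single-problem summit, `Summit.<S>.<S>.…` by design
set_option linter.dupNamespace false

namespace Summit.FinalStateConjecture.FinalStateConjecture.Theorems.NonTrappingHawkingRigidity.AzimuthalPartialAnalyticity.SlabPatching

open Set Filter Function Bundle Manifold Literature.Geometry.Lorentzian
open scoped Manifold ContDiff Topology

variable {E : Type*} [NormedAddCommGroup E] [NormedSpace ℝ E] {H : Type*} [TopologicalSpace H]
  {I : ModelWithCorners ℝ E H} {M : Type*} [TopologicalSpace M] [ChartedSpace H M]
  [IsManifold I ∞ M]

section Frame

variable [I.Boundaryless] {ι : Type*} (b : Module.Basis ι ℝ E) {x₀ p : M}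

/-- **Partial derivatives of a `C^∞` function are `C^∞`.** For `F : M → ℝ` of class `C^∞` on an
open set `U` and a point `p ∈ U` of the chart domain of `x₀`, the function `y ↦ dF_y(∂ᵢ|_y)` (`∂ᵢ`
the coordinate frame of the chart at `x₀`) is `C^∞` at `p`: in the chart it is
`D(F ∘ φ⁻¹)(φ y) bᵢ` (`mvfderiv_apply_localFrame`; the `C²`→`C¹` version is the tree's
`contMDiffAt_mvfderiv_localFrame`). [folklore] -/
theorem contMDiffAt_mvfderiv_localFrame_infty {F : M → ℝ} {U : Set M} (hU : IsOpen U)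
    (hF : ContMDiffOn I 𝓘(ℝ, ℝ) ∞ F U) (hp : p ∈ (chartAt H x₀).source) (hpU : p ∈ U) (i : ι) :
    ContMDiffAt I 𝓘(ℝ, ℝ) ∞
      (fun y ↦ mvfderiv I F y ((trivializationAt E (TangentSpace I) x₀).localFrame b i y)) p := by
  have hFp : CMDiffAt ∞ F p := (hF p hpU).contMDiffAt (hU.mem_nhds hpU)
  -- `F ∘ φ⁻¹` is `C^∞` at `φ p`
  have hz : extChartAt I x₀ p ∈ (extChartAt I x₀).target :=
    (extChartAt I x₀).map_source (by rwa [extChartAt_source])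
  have hsymm : ContMDiffAt 𝓘(ℝ, E) I ∞ (extChartAt I x₀).symm (extChartAt I x₀ p) :=
    (contMDiffOn_extChartAt_symm (n := ∞) x₀).contMDiffAt
      ((isOpen_extChartAt_target x₀).mem_nhds hz)
  have hp' : (extChartAt I x₀).symm (extChartAt I x₀ p) = p := (extChartAt I x₀).left_inv
    (by rwa [extChartAt_source])
  have hcomp : ContMDiffAt 𝓘(ℝ, E) 𝓘(ℝ, ℝ) ∞ (F ∘ (extChartAt I x₀).symm) (extChartAt I x₀ p) :=
    (hp' ▸ hFp).comp _ hsymm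
  have hcd : ContDiffAt ℝ ∞ (F ∘ (extChartAt I x₀).symm) (extChartAt I x₀ p) :=
    contMDiffAt_iff_contDiffAt.1 hcomp
  have hfd : ContDiffAt ℝ ∞ (fun z ↦ fderiv ℝ (F ∘ (extChartAt I x₀).symm) z (b i))
      (extChartAt I x₀ p) :=
    (hcd.fderiv_right (m := ∞) le_rfl).clm_apply contDiffAt_const
  have h1 : ContMDiffAt I 𝓘(ℝ, ℝ) ∞
      (fun y ↦ fderiv ℝ (F ∘ (extChartAt I x₀).symm) (extChartAt I x₀ y) (b i)) p :=
    hfd.contMDiffAt.comp p (contMDiffAt_extChartAt' (n := ∞) hp)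
  -- near `p`, the two functions agree
  have hev : ∀ᶠ y in 𝓝 p, y ∈ (chartAt H x₀).source ∧ y ∈ U :=
    Filter.Eventually.and ((chartAt H x₀).open_source.mem_nhds hp) (hU.mem_nhds hpU)
  refine h1.congr_of_eventuallyEq ?_
  filter_upwards [hev] with y hy
  exact mvfderiv_apply_localFrame b hy.1
    (((hF y hy.2).contMDiffAt (hU.mem_nhds hy.2)).mdifferentiableAt (by simp)) i

end Frame

variable [FiniteDimensional ℝ E] [I.Boundaryless]
  (g : PseudoRiemannianMetric I ∞ E (TangentSpace I : M → Type _))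

/-- **The gradient of a `C^∞` function is a `C^∞` vector field.** For `F : M → ℝ` of class `C^∞`
on an open set `U`, the gradient section `y ↦ grad F (y) = ♯(dF_y)` is a `C^∞` section of `TM` on
`U`: on the chart domain of a point `p ∈ U`, `grad F = ∑ₗ (∑ₖ dF(∂ₖ) 𝒢^{kl}) ∂ₗ`
(`eq_sum_gram_inv_smul_localFrame`, `val_sharp_apply`) with `C^∞` coefficients
(`contMDiffAt_mvfderiv_localFrame_infty`, `contMDiffOn_gram_localFrame_inv`). O'Neill 1983,
Ch. 3, Def. 3.9 ff. (gradient). [cite: ONeill1983, Ch. 3, Def. 3.9] -/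
theorem contMDiffOn_sharp_mvfderiv [CompleteSpace E] {F : M → ℝ} {U : Set M} (hU : IsOpen U)
    (hF : ContMDiffOn I 𝓘(ℝ, ℝ) ∞ F U) :
    ContMDiffOn I (I.prod 𝓘(ℝ, E)) ∞
      (fun y ↦ (TotalSpace.mk' E y (g.sharp y (mvfderiv I F y).toLinearMap : TangentSpace I y) :
        TangentBundle I M)) U := by
  classical
  intro p hpU
  apply ContMDiffAt.contMDiffWithinAt
  set bE := Module.finBasis ℝ E with hbE
  have hp : p ∈ (chartAt H p).source := mem_chart_source H p
  -- the coefficient functions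
  set c : Fin (Module.finrank ℝ E) → M → ℝ := fun l y ↦
    ∑ k, mvfderiv I F y ((trivializationAt E (TangentSpace I) p).localFrame bE k y) *
      (Matrix.of fun i j ↦ g.val y ((trivializationAt E (TangentSpace I) p).localFrame bE i y)
        ((trivializationAt E (TangentSpace I) p).localFrame bE j y))⁻¹ k l with hc
  have hbase : p ∈ (trivializationAt E (TangentSpace I) p).baseSet := by simp
  have hs : ∀ l, CMDiffAt ∞ (T% ((trivializationAt E (TangentSpace I) p).localFrame bE l)) p :=
    fun l ↦ contMDiffAt_localFrame_of_mem ∞ _ bE l hbase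
  have hginv : ∀ k l, ContMDiffAt I 𝓘(ℝ, ℝ) ∞ (fun y ↦
      (Matrix.of fun i j ↦ g.val y ((trivializationAt E (TangentSpace I) p).localFrame bE i y)
        ((trivializationAt E (TangentSpace I) p).localFrame bE j y))⁻¹ k l) p := fun k l ↦
    (contMDiffOn_gram_localFrame_inv
      (trivializationAt E (TangentSpace I) p) g bE k l p hbase).contMDiffAt
      ((trivializationAt E (TangentSpace I) p).open_baseSet.mem_nhds hbase)
  have hcoef : ∀ l, ContMDiffAt I 𝓘(ℝ, ℝ) ∞ (c l) p := fun l ↦ by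
    refine ContMDiffAt.sum fun k _ ↦ ?_
    exact (contMDiffAt_mvfderiv_localFrame_infty bE hU hF hp hpU k).mul (hginv k l)
  have hσ : ∀ l,
      CMDiffAt ∞ (T% ((c l) • ((trivializationAt E (TangentSpace I) p).localFrame bE l))) p :=
    fun l ↦ (hcoef l).smul_section (hs l)
  have hsum : CMDiffAt ∞
      (T% (fun y ↦ ∑ l, ((c l) • ((trivializationAt E (TangentSpace I) p).localFrame bE l)) y))
      p :=
    ContMDiffAt.sum_section (I := I) (V := (TangentSpace I : M → Type _))
      (s := Finset.univ)
      (t := fun l ↦ (c l) • ((trivializationAt E (TangentSpace I) p).localFrame bE l))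
      (x₀ := p) (fun l _ ↦ hσ l)
  -- near `p`, the gradient is that frame combination
  refine hsum.congr_of_eventuallyEq ?_
  filter_upwards [(chartAt H p).open_source.mem_nhds hp] with y hy
  show (TotalSpace.mk' E y (g.sharp y (mvfderiv I F y).toLinearMap) : TangentBundle I M) =
    TotalSpace.mk' E y (∑ l, ((c l) • ((trivializationAt E (TangentSpace I) p).localFrame bE l)) y)
  congr 1
  rw [eq_sum_gram_inv_smul_localFrame g bE hy
    (g.sharp y (mvfderiv I F y).toLinearMap)]
  simp only [hc, Pi.smul_apply', PseudoRiemannianMetric.val_sharp_apply]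
  rfl

omit [I.Boundaryless] in
/-- Defining identity of the gradient: `g(grad F, u) = dF(u)`. O'Neill 1983, Ch. 3, Def. 3.9.
[cite: ONeill1983, Ch. 3, Def. 3.9] -/
theorem val_sharp_mvfderiv (F : M → ℝ) (y : M) (u : TangentSpace I y) :
    g.val y (g.sharp y (mvfderiv I F y).toLinearMap) u = mfderiv I 𝓘(ℝ, ℝ) F y u := by
  rw [PseudoRiemannianMetric.val_sharp_apply]
  rfl

omit [I.Boundaryless] in
/-- **A vector `w` with `dF = g(w, ·)` is the gradient** (nondegeneracy of `g`). O'Neill 1983,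
Ch. 3, Def. 3.9 ff. [cite: ONeill1983, Ch. 3, Def. 3.9] -/
theorem sharp_mvfderiv_eq_of_forall (F : M → ℝ) (y : M) (w : TangentSpace I y)
    (hw : ∀ u : TangentSpace I y, mfderiv I 𝓘(ℝ, ℝ) F y u = g.val y w u) :
    g.sharp y (mvfderiv I F y).toLinearMap = w :=
  PseudoRiemannianMetric.sharp_eq_of_forall g y _ w fun u ↦ (hw u).symm

omit [I.Boundaryless] in
/-- `dF(grad F) = g(grad F, grad F)`: along its gradient a function changes at the rate
`|grad F|²_g` (positive where the gradient is spacelike). O'Neill 1983, Ch. 3, Def. 3.9 ff.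
[cite: ONeill1983, Ch. 3, Def. 3.9] -/
theorem mfderiv_sharp_mvfderiv_self (F : M → ℝ) (y : M) :
    mfderiv I 𝓘(ℝ, ℝ) F y (g.sharp y (mvfderiv I F y).toLinearMap) =
      g.val y (g.sharp y (mvfderiv I F y).toLinearMap)
        (g.sharp y (mvfderiv I F y).toLinearMap) := by
  rw [val_sharp_mvfderiv]

/-- **Registered form (sub-goal `stub_slabPatching_gradient` of stub S3 `stub_slabPatching`):
the gradient of a sweep function.** For `f` of class `C^∞` on an open set `O` of the carrier of
a stationary black hole, `grad f = ♯(df)` is a `C^∞` vector field on `O`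
(`contMDiffOn_sharp_mvfderiv`), it pairs to `df` (`g(grad f, u) = df(u)`), and any `w` with
`df = g(w, ·)` is `grad f` (so where the sweep has spacelike gradient `w`, `df(grad f) = g(w, w) > 0`).
[cite: ONeill1983, Ch. 3, Def. 3.9] -/
theorem stub_slabPatching_gradient :
    ∀ (𝓑 : StationaryAFBlackHole.{0}) (O : Set 𝓑.carrier) (f : 𝓑.carrier → ℝ), IsOpen O →
      ContMDiffOn (𝓡 4) 𝓘(ℝ, ℝ) ((⊤ : ℕ∞) : WithTop ℕ∞) f O →
      ContMDiffOn (𝓡 4) ((𝓡 4).prod 𝓘(ℝ, E4)) ((⊤ : ℕ∞) : WithTop ℕ∞)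
        (fun x ↦ (Bundle.TotalSpace.mk' E4 x
          (𝓑.metric.sharp x (mvfderiv (𝓡 4) f x).toLinearMap : TangentSpace (𝓡 4) x) :
            TangentBundle (𝓡 4) 𝓑.carrier)) O ∧
      (∀ (x : 𝓑.carrier) (u : TangentSpace (𝓡 4) x),
        𝓑.metric.val x (𝓑.metric.sharp x (mvfderiv (𝓡 4) f x).toLinearMap) u =
          mfderiv (𝓡 4) 𝓘(ℝ, ℝ) f x u) ∧
      ∀ (x : 𝓑.carrier) (w : TangentSpace (𝓡 4) x),
        (∀ u : TangentSpace (𝓡 4) x, mfderiv (𝓡 4) 𝓘(ℝ, ℝ) f x u = 𝓑.metric.val x w u) →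
        𝓑.metric.sharp x (mvfderiv (𝓡 4) f x).toLinearMap = w := by
  intro 𝓑 O f hO hf
  exact ⟨contMDiffOn_sharp_mvfderiv 𝓑.metric.toPseudoRiemannianMetric hO hf,
    fun x u ↦ val_sharp_mvfderiv 𝓑.metric.toPseudoRiemannianMetric f x u,
    fun x w hw ↦ sharp_mvfderiv_eq_of_forall 𝓑.metric.toPseudoRiemannianMetric f x w hw⟩

end Summit.FinalStateConjecture.FinalStateConjecture.Theorems.NonTrappingHawkingRigidity.AzimuthalPartialAnalyticity.SlabPatching

end
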